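import Summits.QuantumFields.YangMills.Theorems.ColdStartUniversalityUniformColdStartMixingNearUniformLoopStrings
import Summits.QuantumFields.YangMills.Theorems.ColdStartUniversalityLatticeLangevinWilsonLogSobolev
import HarnessLib

/-!
# Route `ColdStartUniversality` (fixed-cut-off package): the transport–entropy bounds at EVERY coupling `β'`, UNCONDITIONALLY — with the
# Holley–Stroock log-Sobolev constant `ρ = ½·e^(−4|β'|·#𝒫)` (the honest all-coupling witness)

Helper file (seat `ym-line-csu-p1`, g28; `--supports stmt-QuantumFields-24809`).  The `ρ`-parametric statements of `…MacroscopicMixingOfLogSobolev` /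
`…NearUniformLoopStrings` take a log-Sobolev inequality as HYPOTHESIS.  At every FIXED cut-off that hypothesis is a theorem with the (volume- and
coupling-catastrophic) Holley–Stroock constant `ρ_HS = ½e^(−4|β'|#𝒫)` (g22 `wilson_generatorLogSobolev_explicit`), so the conclusions hold
UNCONDITIONALLY at every `(L, β')`:
* ★★ `wilson_coldStart_loopAverage_allCoupling` — `|E W̄(U_(2+u)) − ∫W̄ dμ_(β')| ≤ e^(−2ρ_HS u)·(R+T)·√(48(366|β'|+3)/ρ_HS)`;
* ★★ `wilson_coldStart_loopString_allCoupling` — the same for loop strings with `Σ_k(R_k+T_k)`;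
* ★★ `wilson_coldStart_actionDensity_allCoupling` — `|E S_W(U_(2+u))/#𝒫 − μ(S_W/#𝒫)| ≤ e^(−2ρ_HS u)·√(64·B_L/(#𝒫·2ρ_HS))`.
READING (planner-facing, honest): the (ULS)-conditional near-uniform theorems (`nearUniform_…_of_uniformLogSobolev`) are therefore NON-VACUOUS at
every cut-off — what (ULS) asserts is not the existence of SOME log-Sobolev constant (here: `ρ_HS ≍ e^(−12β'_K L_K³)`, a threshold super-exponential in
the number of plaquettes, the BC5-type witness of weakness already recorded by g22/g27) but its SIZE `c·ε_K`.  Inside the window `|β'| < 1/12` use the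
Bakry–Émery files instead (`ρ = (1−12|β'|)/2`, volume-free).  FIXED cut-off; nothing K-uniform; 24809 ASIDE not restated; no crux, rung or summit
statement is proved; the Yang–Mills mass gap is NOT proved.  THEOREMS ONLY, no definition, no sorry.
[cite: BakryGentilLedoux2014, Prop. 5.7.1 and Prop. 5.1.6]
-/

set_option autoImplicit false

noncomputable section

namespace Summit.QuantumFields.YangMills.Theorems.ColdStartUniversality

open MeasureTheory ProbabilityTheory Finset Filter Set InformationTheory
open scoped BigOperators NNReal ENNReal Topology Matrix
open Literature.Probability.Process Literature.MathematicalPhysics.QuantumFieldTheory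
open Literature.MathematicalPhysics.QuantumLattice (fundamentalRep fundamentalLatticeRep continuous_fundamentalRep)

variable {L : ℕ} [NeZero L]

/-- `0 < ρ_HS = ½e^(−4|β'|#𝒫)`. [folklore] -/
theorem holleyStroockConst_pos (L : ℕ) [NeZero L] (β' : ℝ) : 0 < (1 / 2 * Real.exp (-(|β'| * (4 * (Fintype.card (Plaquette 3 L) : ℝ))))) := by positivity

/-- ★★ **All-coupling cold-start equilibration of the spatially averaged Wilson loop** (every `L`, EVERY `β'`, `R + T > 0`, every deterministic start,
every solution, `u ≥ 0`): `|E W̄(U_(2+u)) − ∫W̄ dμ_(β')| ≤ e^(−2ρ_HS u)·(R+T)·√(48(366|β'|+3)/ρ_HS)`, `ρ_HS = ½e^(−4|β'|#𝒫)`.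
[cite: BakryGentilLedoux2014, Prop. 5.7.1 and Prop. 5.1.6] -/
theorem wilson_coldStart_loopAverage_allCoupling (L : ℕ) [NeZero L] (β' : ℝ) (i j : Fin 3) (R T : ℕ) (hRT : 0 < R + T)
    (z : (GaugeConfig 3 L (Matrix.specialUnitaryGroup (Fin 2) ℂ)))
    {Ω : Type} [MeasurableSpace Ω] {P : Measure Ω} [IsProbabilityMeasure P]
    {W : ℝ≥0 → Ω → (Edge 3 L × NoiseIdx 2 → ℝ)} (hW : IsFlatBrownian W P)
    {U : ℝ≥0 → Ω → (GaugeConfig 3 L (Matrix.specialUnitaryGroup (Fin 2) ℂ))} (hU0 : ∀ ω, U 0 ω = z)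
    (hU : (latticeLangevinDynamics (fundamentalLatticeRep 2) β').IsSolution (fundamentalRep (Fin 2)) hW.natFiltration P W U)
    (u : ℝ≥0) :
    |(∫ ω, (((Fintype.card (Site 3 L) : ℝ))⁻¹ * ∑ x : Site 3 L, wilsonLoop (fundamentalRep (Fin 2)) x i j R T (U ((2 : ℝ≥0) + u) ω)) ∂P) - ∫ V, (((Fintype.card (Site 3 L) : ℝ))⁻¹ * ∑ x : Site 3 L, wilsonLoop (fundamentalRep (Fin 2)) x i j R T V) ∂(wilsonMeasure (d := 3) (L := L) (fundamentalRep (Fin 2)) β')| ≤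
      Real.exp (-(2 * (1 / 2 * Real.exp (-(|β'| * (4 * (Fintype.card (Plaquette 3 L) : ℝ)))))) * u) * (((R : ℝ) + T) * Real.sqrt (48 * (366 * |β'| + 3) / (1 / 2 * Real.exp (-(|β'| * (4 * (Fintype.card (Plaquette 3 L) : ℝ))))))) :=
  wilson_coldStart_loopAverage_le_coupling_of_logSobolev L β' i j (holleyStroockConst_pos L β') R T hRT z
    (fun f hf => wilson_generatorLogSobolev_explicit L β' f hf) hW hU0 hU u

/-- ★★ **All-coupling cold-start equilibration of loop strings** (every `L`, EVERY `β'`, `Σ_k(R_k+T_k) > 0`):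
`|E ∏_k W̄_k(U_(2+u)) − ∫∏_k W̄_k dμ_(β')| ≤ e^(−2ρ_HS u)·(Σ_k(R_k+T_k))·√(48(366|β'|+3)/ρ_HS)`. [cite: BakryGentilLedoux2014, Prop. 5.7.1 and Prop. 5.1.6] -/
theorem wilson_coldStart_loopString_allCoupling (L : ℕ) [NeZero L] (β' : ℝ) (m : ℕ) (i j : Fin m → Fin 3) (R T : Fin m → ℕ)
    (hRT : 0 < ∑ k, (R k + T k)) (z : (GaugeConfig 3 L (Matrix.specialUnitaryGroup (Fin 2) ℂ)))
    {Ω : Type} [MeasurableSpace Ω] {P : Measure Ω} [IsProbabilityMeasure P]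
    {W : ℝ≥0 → Ω → (Edge 3 L × NoiseIdx 2 → ℝ)} (hW : IsFlatBrownian W P)
    {U : ℝ≥0 → Ω → (GaugeConfig 3 L (Matrix.specialUnitaryGroup (Fin 2) ℂ))} (hU0 : ∀ ω, U 0 ω = z)
    (hU : (latticeLangevinDynamics (fundamentalLatticeRep 2) β').IsSolution (fundamentalRep (Fin 2)) hW.natFiltration P W U)
    (u : ℝ≥0) :
    |(∫ ω, (∏ k : Fin m, (((Fintype.card (Site 3 L) : ℝ))⁻¹ * ∑ x : Site 3 L, wilsonLoop (fundamentalRep (Fin 2)) x (i k) (j k) (R k) (T k) (U ((2 : ℝ≥0) + u) ω))) ∂P) - ∫ V, (∏ k : Fin m, (((Fintype.card (Site 3 L) : ℝ))⁻¹ * ∑ x : Site 3 L, wilsonLoop (fundamentalRep (Fin 2)) x (i k) (j k) (R k) (T k) V)) ∂(wilsonMeasure (d := 3) (L := L) (fundamentalRep (Fin 2)) β')| ≤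
      Real.exp (-(2 * (1 / 2 * Real.exp (-(|β'| * (4 * (Fintype.card (Plaquette 3 L) : ℝ)))))) * u) * ((∑ k : Fin m, ((R k : ℝ) + T k)) * Real.sqrt (48 * (366 * |β'| + 3) / (1 / 2 * Real.exp (-(|β'| * (4 * (Fintype.card (Plaquette 3 L) : ℝ))))))) :=
  wilson_coldStart_loopString_le_coupling_of_logSobolev L β' m i j (holleyStroockConst_pos L β') R T hRT z
    (fun f hf => wilson_generatorLogSobolev_explicit L β' f hf) hW hU0 hU u

/-- ★★ **All-coupling cold-start equilibration of the action density** (every `L`, EVERY `β'`):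
`|E S_W(U_(2+u))/#𝒫 − ∫S_W/#𝒫 dμ_(β')| ≤ e^(−2ρ_HS u)·√(64·B_L/(#𝒫·2ρ_HS))`, `B_L = 366|β'|L³ + 3log(3/2)L³ + log 2`.
[cite: BakryGentilLedoux2014, Prop. 5.7.1 and Prop. 5.1.6] -/
theorem wilson_coldStart_actionDensity_allCoupling (L : ℕ) [NeZero L] (β' : ℝ)
    (z : (GaugeConfig 3 L (Matrix.specialUnitaryGroup (Fin 2) ℂ)))
    {Ω : Type} [MeasurableSpace Ω] {P : Measure Ω} [IsProbabilityMeasure P]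
    {W : ℝ≥0 → Ω → (Edge 3 L × NoiseIdx 2 → ℝ)} (hW : IsFlatBrownian W P)
    {U : ℝ≥0 → Ω → (GaugeConfig 3 L (Matrix.specialUnitaryGroup (Fin 2) ℂ))} (hU0 : ∀ ω, U 0 ω = z)
    (hU : (latticeLangevinDynamics (fundamentalLatticeRep 2) β').IsSolution (fundamentalRep (Fin 2)) hW.natFiltration P W U)
    (u : ℝ≥0) :
    |(∫ ω, wilsonAction (fundamentalRep (Fin 2)) (U ((2 : ℝ≥0) + u) ω) / (Fintype.card (Plaquette 3 L) : ℝ) ∂P) -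
        ∫ V, wilsonAction (fundamentalRep (Fin 2)) V / (Fintype.card (Plaquette 3 L) : ℝ) ∂(wilsonMeasure (d := 3) (L := L) (fundamentalRep (Fin 2)) β')| ≤
      Real.exp (-(2 * (1 / 2 * Real.exp (-(|β'| * (4 * (Fintype.card (Plaquette 3 L) : ℝ)))))) * u) * Real.sqrt (64 * (366 * |β'| * (L : ℝ) ^ 3 + 3 * Real.log (3 / 2) * (L : ℝ) ^ 3 + Real.log 2) / ((Fintype.card (Plaquette 3 L) : ℝ) * (2 * (1 / 2 * Real.exp (-(|β'| * (4 * (Fintype.card (Plaquette 3 L) : ℝ)))))))) :=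
  wilson_coldStart_actionDensity_le_exp_of_logSobolev L β' (holleyStroockConst_pos L β') z
    (fun f hf => wilson_generatorLogSobolev_explicit L β' f hf) hW hU0 hU u

end Summit.QuantumFields.YangMills.Theorems.ColdStartUniversality
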